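import Mathlib
import Summits.NavierStokesRegularity.NavierStokesRegularity.Theorems.EulerZoomLiouvillePowerGaugeEulerLiouvilleGalileanFrameShear
import Summits.NavierStokesRegularity.NavierStokesRegularity.Theorems.EulerZoomLiouvillePowerGaugeEulerLiouvilleGalileanFrameSteadyEuler
import Summits.NavierStokesRegularity.NavierStokesRegularity.Theorems.EulerZoomLiouvillePowerGaugeEulerLiouvilleRigidFramePairing
import Summits.NavierStokesRegularity.NavierStokesRegularity.Theorems.EulerZoomLiouvillePowerGaugeEulerLiouvilleRigidFrameSlab
import Summits.NavierStokesRegularity.NavierStokesRegularity.Theorems.EulerZoomLiouvillePowerGaugeEulerLiouvilleRigidFrameContinuity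
import Literature.Analysis.FluidPDE.WeakSolution
import Literature.Analysis.FluidPDE.DistributionalToWeak
import HarnessLib

/-!
# RIGID-FRAME-STEADY MEMBERS: THE TENSOR-TESTED WEAK EULER IDENTITY IN THE BODY FRAME (lab form)
# (crux `EulerZoomLiouville.PowerGaugeEulerLiouville` = stmt-NavierStokesRegularity-19832; «E(3)-steady, escaping» stratum, step (ii); width seat ns-ezl-w3 g5)

Route №10 `EulerZoomLiouville`, crux E.  Rotational twin of `…GalileanFrameSteadyEuler.lean` (F1e step (ii)).  A RIGID-FRAME-STEADY member
`u(τ, x) = R(τ) U(R(τ)⁻¹(x − ξ(τ)))` (`τ < T₁ ≤ 0`; `R, R⁻¹` continuous (resp. `C¹`) paths of mutually inverse linear isometries, `ξ` continuous (resp. `C¹`),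
no background; `U, |U|² ∈ L¹_loc`) of a distributional Euler pair on `(−∞,0) × ℝ³`:

* `RigidFrame.integral_tensorTest_rigid` — momentum identity tested with `χ(τ)Φ(x)` (`Φ` divergence free, `χ` supported in `(−∞,T₁)`), pulled back to
  the body frame: `∫ (χ′ f_Φ + χ N_Φ) dτ = 0`, `f_Φ(τ) = ∫⟪R(τ)U, Φ(R(τ)· + ξ(τ))⟫`, `N_Φ(τ) = ∫⟪R(τ)U, DΦ(R(τ)· + ξ(τ)) R(τ)U⟫`;
* `RigidFrame.integral_scalarTensorTest_rigid` — the divergence identity tested with `χ(τ)φ(x)`: `∫ χ(τ) ∫⟪R(τ)U, ∇φ(R(τ)· + ξ(τ))⟫ dτ = 0`;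
* `RigidFrame.integral_inner_fderiv_rigid_eq` — hence, AT EVERY `τ < T₁` and for every divergence-free test field `Φ`:
  `∫ ⟪R U, DΦ(R· + ξ) R U⟫ = ∫ ⟪R′ U, Φ(R· + ξ)⟫ + ∫ ⟪R U, DΦ(R· + ξ)(R′· + ξ′)⟫` (by parts + fundamental lemma, the pairing being `C¹` by
  `RigidFrame.hasDerivAt_integral_inner_rigid_path`).

The body-frame rewriting (`∫⟪U, DΦ̃(A· + v) − AΦ̃⟫ = ∫⟪U, DΦ̃ U⟫`, `A = R⁻¹R′` skew, `v = R⁻¹ξ′`) and the two-time difference feeding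
`Killing.screwShearVanishes` are the companion file `…RigidFrameBodyFrame.lean`.

WHAT THIS IS NOT: not NS regularity, not the crux E — slice identities toward one more symmetry stratum of the crux CLASS 19832 (MODEL lattice; E/NS
strata), `--supports` stmt-19832; 19832 OPEN. [folklore; CaffarelliKohnNirenberg1982 §2 (2.1)–(2.2); MajdaBertozzi2002 Prop. 1.1 p. 12]
-/

noncomputable section

-- flat `Theorems/<Route><Decl>…` files of one crux share the namespace of the crux (tree convention: `Summit.<S>.<S>.…`)
set_option linter.dupNamespace false

open MeasureTheory Set Filter Topology Metric Function TopologicalSpace InnerProductSpace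
open scoped ENNReal NNReal RealInnerProductSpace ContDiff

namespace Summit.NavierStokesRegularity.NavierStokesRegularity.Theorems.PowerGaugeEulerLiouville

namespace RigidFrame

open Literature.Analysis Literature.Analysis.FunctionSpaces Literature.Analysis.FluidPDE
open Summit.NavierStokesRegularity.NavierStokesRegularity.Theorems.PowerGaugeEulerLiouville.GalileanFrames

variable {U : EuclideanSpace ℝ (Fin 3) → EuclideanSpace ℝ (Fin 3)} {ξ : ℝ → EuclideanSpace ℝ (Fin 3)}
  {R Rinv : ℝ → EuclideanSpace ℝ (Fin 3) →L[ℝ] EuclideanSpace ℝ (Fin 3)}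
  {u : ℝ → EuclideanSpace ℝ (Fin 3) → EuclideanSpace ℝ (Fin 3)} {p : ℝ → EuclideanSpace ℝ (Fin 3) → ℝ} {T₁ : ℝ}

/-- **THE MOMENTUM IDENTITY OF A RIGID-FRAME-STEADY MEMBER, TESTED WITH A TENSOR FIELD** `χ(τ)Φ(x)` (`Φ` divergence free, `χ` supported in
`(−∞, T₁)`), in the body frame: `∫ (χ'(τ) ∫⟪R U, Φ(R· + ξ)⟫ + χ(τ) ∫⟪R U, DΦ(R· + ξ) R U⟫) dτ = 0`. [cite: CaffarelliKohnNirenberg1982, §2 (2.1)–(2.2)] -/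
theorem integral_tensorTest_rigid
    (hsol : IsDistributionalNSSolutionOn (slab (EuclideanSpace ℝ (Fin 3)) (Iio 0) isOpen_Iio) 0 0 u p)
    (hT₁ : T₁ ≤ 0) (hu : ∀ τ : ℝ, τ < T₁ → u τ = fun x => R τ (U (Rinv τ (x - ξ τ))))
    (hUm : AEStronglyMeasurable U volume) (hU : LocallyIntegrable U volume)
    (hU2 : LocallyIntegrable (fun z => ‖U z‖ ^ 2) volume) (hξ : Continuous ξ)
    (hR : Continuous R) (hRinv : Continuous Rinv) (hRi : ∀ τ w, ‖R τ w‖ = ‖w‖)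
    (h1 : ∀ τ x, R τ (Rinv τ x) = x) (h2 : ∀ τ w, Rinv τ (R τ w) = w)
    {Φ : EuclideanSpace ℝ (Fin 3) → EuclideanSpace ℝ (Fin 3)} (hΦ : IsTestFunctionOn (⊤ : Opens (EuclideanSpace ℝ (Fin 3))) Φ)
    (hdiv : ∀ z, VectorCalculus.divergence Φ z = 0)
    {χ : ℝ → ℝ} (hχ : ContDiff ℝ (⊤ : ℕ∞) χ) (hχc : HasCompactSupport χ) (hχT : tsupport χ ⊆ Iio T₁) :
    ∫ τ, (deriv χ τ * (∫ w, ⟪R τ (U w), Φ (R τ w + ξ τ)⟫) +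
      χ τ * ∫ w, ⟪R τ (U w), (fderiv ℝ Φ (R τ w + ξ τ)) (R τ (U w))⟫) = 0 := by
  have hΦc : Continuous Φ := hΦ.contDiff.continuous
  have hΦd : Differentiable ℝ Φ := hΦ.contDiff.differentiable (by simp)
  have hDΦc : Continuous (fderiv ℝ Φ) := hΦ.contDiff.continuous_fderiv (by simp)
  have hDΦs : HasCompactSupport (fderiv ℝ Φ) := hΦ.hasCompactSupport.fderiv (𝕜 := ℝ)
  have hχd : Differentiable ℝ χ := hχ.differentiable (by simp)
  have hχ'c : Continuous (deriv χ) := hχ.continuous_deriv (by simp)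
  have hχ0 : ∀ t, T₁ ≤ t → χ t = 0 := fun t ht =>
    image_eq_zero_of_notMem_tsupport fun h => (not_lt.2 ht) (hχT h)
  have hχ'0 : ∀ t, T₁ ≤ t → deriv χ t = 0 := fun t ht => by
    by_contra hne; exact (not_lt.2 ht) (hχT (support_deriv_subset (mem_support.2 hne)))
  have hΨ : IsSpaceTimeTestOn (slab (EuclideanSpace ℝ (Fin 3)) (Iio 0) isOpen_Iio)
      (fun s (x : EuclideanSpace ℝ (Fin 3)) => χ s • Φ x) :=
    isSpaceTimeTestOn_slab_smul isOpen_Iio hχ hχc (hχT.trans (Iio_subset_Iio hT₁)) hΦ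
  have id0 := hsol.2.2.2.2 _ hΨ
  -- the body-frame integrand
  set F : ℝ → EuclideanSpace ℝ (Fin 3) → ℝ := fun τ w =>
    deriv χ τ * ⟪R τ (U w), Φ (R τ w + ξ τ)⟫ + χ τ * ⟪R τ (U w), (fderiv ℝ Φ (R τ w + ξ τ)) (R τ (U w))⟫ with hF
  have hslab : ((slab (EuclideanSpace ℝ (Fin 3)) (Iio 0) isOpen_Iio : Opens (ℝ × EuclideanSpace ℝ (Fin 3))) :
      Set (ℝ × EuclideanSpace ℝ (Fin 3))) = Iio (0 : ℝ) ×ˢ (univ : Set (EuclideanSpace ℝ (Fin 3))) :=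
    coe_slab (X := EuclideanSpace ℝ (Fin 3)) (Iio 0) isOpen_Iio
  have hFint : ∫ z in Iio (0 : ℝ) ×ˢ (univ : Set (EuclideanSpace ℝ (Fin 3))), F z.1 (Rinv z.1 (z.2 - ξ z.1)) = 0 := by
    rw [← hslab]
    refine Eq.trans (setIntegral_congr_fun
      (slab (EuclideanSpace ℝ (Fin 3)) (Iio 0) isOpen_Iio).isOpen.measurableSet fun z _ => ?_) id0
    have hTD : timeDeriv (fun s (x : EuclideanSpace ℝ (Fin 3)) => χ s • Φ x) z.1 z.2 = deriv χ z.1 • Φ z.2 := by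
      rw [timeDeriv_apply]; exact deriv_smul_const (hχd z.1) (Φ z.2)
    have hCV : convect (u z.1) (fun x : EuclideanSpace ℝ (Fin 3) => χ z.1 • Φ x) z.2 =
        χ z.1 • (fderiv ℝ Φ z.2) (u z.1 z.2) := by
      rw [convect_apply, fderiv_fun_const_smul (hΦd z.2) (χ z.1)]
      rfl
    have hDV : VectorCalculus.divergence (fun x : EuclideanSpace ℝ (Fin 3) => χ z.1 • Φ x) z.2 = 0 := by
      rw [divergence_const_smul hΦd, hdiv, mul_zero]
    rw [hTD, hCV, hDV]
    simp only [zero_mul, add_zero, mul_zero, Pi.zero_apply, inner_zero_left, inner_smul_right]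
    by_cases ht : z.1 < T₁
    · rw [hu z.1 ht]
      simp only [hF, h1, sub_add_cancel]
    · simp only [hF, hχ0 z.1 (not_lt.1 ht), hχ'0 z.1 (not_lt.1 ht), zero_mul, add_zero]
  have hF0 : ∀ τ : ℝ, 0 ≤ τ → ∀ z, F τ z = 0 := fun τ hτ z => by
    simp only [hF, hχ0 τ (hT₁.trans hτ), hχ'0 τ (hT₁.trans hτ), zero_mul, add_zero]
  have hFi : Integrable (uncurry F) ((volume : Measure ℝ).prod (volume : Measure (EuclideanSpace ℝ (Fin 3)))) := by
    have i1 := integrable_rigid_linear hU hξ hR hRi hχ'c hχc.deriv hΦc hΦ.hasCompactSupport (U := U)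
    have i2 := integrable_rigid_quadratic hUm hU2 hξ hR hRi hχ.continuous hχc hDΦc hDΦs (U := U)
    exact i1.add i2
  rw [setIntegral_slab_rigid_eq hR hRinv hξ.measurable hRi h1 h2 hF0 hFi] at hFint
  rw [← hFint]
  refine integral_congr_ae (Eventually.of_forall fun τ => ?_)
  have i1 : Integrable (fun w => deriv χ τ * ⟪R τ (U w), Φ (R τ w + ξ τ)⟫) volume :=
    (integrable_inner_rigid hU (R τ) (hRi τ) hΦc hΦ.hasCompactSupport (ξ τ)).const_mul _
  have i2 : Integrable (fun w => χ τ * ⟪R τ (U w), (fderiv ℝ Φ (R τ w + ξ τ)) (R τ (U w))⟫) volume :=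
    (integrable_inner_clm_rigid_self hUm hU2 (hRi τ) (hRi τ) hDΦc hDΦs (ξ τ)).const_mul _
  simp only [hF]
  rw [integral_add i1 i2, integral_const_mul, integral_const_mul]

/-- **THE DIVERGENCE IDENTITY OF A RIGID-FRAME-STEADY MEMBER, TESTED WITH A TENSOR** `χ(τ)φ(x)`: `∫ χ(τ) (∫⟪R U, ∇φ(R· + ξ)⟫) dτ = 0`.
[cite: CaffarelliKohnNirenberg1982, §2 (2.1)] -/
theorem integral_scalarTensorTest_rigid
    (hsol : IsDistributionalNSSolutionOn (slab (EuclideanSpace ℝ (Fin 3)) (Iio 0) isOpen_Iio) 0 0 u p)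
    (hT₁ : T₁ ≤ 0) (hu : ∀ τ : ℝ, τ < T₁ → u τ = fun x => R τ (U (Rinv τ (x - ξ τ))))
    (hU : LocallyIntegrable U volume) (hξ : Continuous ξ)
    (hR : Continuous R) (hRinv : Continuous Rinv) (hRi : ∀ τ w, ‖R τ w‖ = ‖w‖)
    (h1 : ∀ τ x, R τ (Rinv τ x) = x) (h2 : ∀ τ w, Rinv τ (R τ w) = w)
    {φ : EuclideanSpace ℝ (Fin 3) → ℝ} (hφ : IsTestFunctionOn (⊤ : Opens (EuclideanSpace ℝ (Fin 3))) φ)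
    {χ : ℝ → ℝ} (hχ : ContDiff ℝ (⊤ : ℕ∞) χ) (hχc : HasCompactSupport χ) (hχT : tsupport χ ⊆ Iio T₁) :
    ∫ τ, χ τ * ∫ w, ⟪R τ (U w), gradient φ (R τ w + ξ τ)⟫ = 0 := by
  have hG := isTestFunctionOn_gradient_field hφ
  have hφd : Differentiable ℝ φ := hφ.contDiff.differentiable (by simp)
  have hχ0 : ∀ t, T₁ ≤ t → χ t = 0 := fun t ht =>
    image_eq_zero_of_notMem_tsupport fun h => (not_lt.2 ht) (hχT h)
  have hΘ : IsSpaceTimeTestOn (slab (EuclideanSpace ℝ (Fin 3)) (Iio 0) isOpen_Iio)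
      (fun s (x : EuclideanSpace ℝ (Fin 3)) => χ s • φ x) :=
    isSpaceTimeTestOn_slab_smul isOpen_Iio hχ hχc (hχT.trans (Iio_subset_Iio hT₁)) hφ
  have id0 := hsol.2.2.2.1 _ hΘ
  set F : ℝ → EuclideanSpace ℝ (Fin 3) → ℝ := fun τ w => χ τ * ⟪R τ (U w), gradient φ (R τ w + ξ τ)⟫ with hF
  have hslab : ((slab (EuclideanSpace ℝ (Fin 3)) (Iio 0) isOpen_Iio : Opens (ℝ × EuclideanSpace ℝ (Fin 3))) :
      Set (ℝ × EuclideanSpace ℝ (Fin 3))) = Iio (0 : ℝ) ×ˢ (univ : Set (EuclideanSpace ℝ (Fin 3))) :=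
    coe_slab (X := EuclideanSpace ℝ (Fin 3)) (Iio 0) isOpen_Iio
  have hFint : ∫ z in Iio (0 : ℝ) ×ˢ (univ : Set (EuclideanSpace ℝ (Fin 3))), F z.1 (Rinv z.1 (z.2 - ξ z.1)) = 0 := by
    rw [← hslab]
    refine Eq.trans (setIntegral_congr_fun
      (slab (EuclideanSpace ℝ (Fin 3)) (Iio 0) isOpen_Iio).isOpen.measurableSet fun z _ => ?_) id0
    have hgr : gradient ((fun s (x : EuclideanSpace ℝ (Fin 3)) => χ s • φ x) z.1) z.2 = χ z.1 • gradient φ z.2 :=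
      gradient_const_mul hφd (χ z.1) z.2
    rw [hgr, inner_smul_right]
    by_cases ht : z.1 < T₁
    · rw [hu z.1 ht]
      simp only [hF, h1, sub_add_cancel]
    · simp only [hF, hχ0 z.1 (not_lt.1 ht), zero_mul]
  have hF0 : ∀ τ : ℝ, 0 ≤ τ → ∀ z, F τ z = 0 := fun τ hτ z => by
    simp only [hF, hχ0 τ (hT₁.trans hτ), zero_mul]
  have hFi : Integrable (uncurry F) ((volume : Measure ℝ).prod (volume : Measure (EuclideanSpace ℝ (Fin 3)))) :=
    integrable_rigid_linear hU hξ hR hRi hχ.continuous hχc hG.contDiff.continuous hG.hasCompactSupport (U := U)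
  rw [setIntegral_slab_rigid_eq hR hRinv hξ.measurable hRi h1 h2 hF0 hFi] at hFint
  rw [← hFint]
  refine integral_congr_ae (Eventually.of_forall fun τ => ?_)
  simp only [hF]
  rw [integral_const_mul]

/-- **THE RIGID-FRAME VELOCITY IDENTITY (lab form).**  For a rigid-frame-steady member (`R, ξ ∈ C¹`, `U, |U|² ∈ L¹_loc`) of a distributional Euler pair
and every divergence-free test field `Φ`, at EVERY `τ < T₁`:
`∫ ⟪R U, DΦ(R· + ξ) R U⟫ = ∫ ⟪R′ U, Φ(R· + ξ)⟫ + ∫ ⟪R U, DΦ(R· + ξ)(R′· + ξ′)⟫` (all paths evaluated at `τ`). [folklore; MajdaBertozzi2002 Prop. 1.1] -/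
theorem integral_inner_fderiv_rigid_eq
    (hsol : IsDistributionalNSSolutionOn (slab (EuclideanSpace ℝ (Fin 3)) (Iio 0) isOpen_Iio) 0 0 u p)
    (hT₁ : T₁ ≤ 0) (hu : ∀ τ : ℝ, τ < T₁ → u τ = fun x => R τ (U (Rinv τ (x - ξ τ))))
    (hUm : AEStronglyMeasurable U volume) (hU : LocallyIntegrable U volume)
    (hU2 : LocallyIntegrable (fun z => ‖U z‖ ^ 2) volume) (hξ : ContDiff ℝ 1 ξ)
    (hR : ContDiff ℝ 1 R) (hRinv : Continuous Rinv) (hRi : ∀ τ w, ‖R τ w‖ = ‖w‖)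
    (h1 : ∀ τ x, R τ (Rinv τ x) = x) (h2 : ∀ τ w, Rinv τ (R τ w) = w)
    {Φ : EuclideanSpace ℝ (Fin 3) → EuclideanSpace ℝ (Fin 3)} (hΦ : IsTestFunctionOn (⊤ : Opens (EuclideanSpace ℝ (Fin 3))) Φ)
    (hdiv : ∀ z, VectorCalculus.divergence Φ z = 0) {τ : ℝ} (hτ : τ < T₁) :
    ∫ w, ⟪R τ (U w), (fderiv ℝ Φ (R τ w + ξ τ)) (R τ (U w))⟫ =
      (∫ w, ⟪deriv R τ (U w), Φ (R τ w + ξ τ)⟫) + ∫ w, ⟪R τ (U w), (fderiv ℝ Φ (R τ w + ξ τ)) (deriv R τ w + deriv ξ τ)⟫ := by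
  have hΦc : Continuous Φ := hΦ.contDiff.continuous
  have hDΦc : Continuous (fderiv ℝ Φ) := hΦ.contDiff.continuous_fderiv (by simp)
  have hDΦs : HasCompactSupport (fderiv ℝ Φ) := hΦ.hasCompactSupport.fderiv (𝕜 := ℝ)
  have hRc : Continuous R := hR.continuous
  have hR'c : Continuous (deriv R) := hR.continuous_deriv le_rfl
  -- the pairing is `C¹` with derivative the (split) sum
  have hder : ∀ t : ℝ, HasDerivAt (fun s : ℝ => ∫ w, ⟪R s (U w), Φ (R s w + ξ s)⟫)
      ((∫ w, ⟪deriv R t (U w), Φ (R t w + ξ t)⟫) + ∫ w, ⟪R t (U w), (fderiv ℝ Φ (R t w + ξ t)) (deriv R t w + deriv ξ t)⟫) t := by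
    intro t
    have h := hasDerivAt_integral_inner_rigid_path hU hξ hR hRi hΦ t
    have i1 : Integrable (fun w => ⟪deriv R t (U w), Φ (R t w + ξ t)⟫) volume :=
      integrable_inner_rigid hU (deriv R t) (hRi t) hΦc hΦ.hasCompactSupport (ξ t)
    have i2 : Integrable (fun w => ⟪R t (U w), (fderiv ℝ Φ (R t w + ξ t)) (deriv R t w + deriv ξ t)⟫) volume := by
      -- `R' w = (R' ∘ R⁻¹)((R w + ξ) − ξ)`: both pieces are pairings with compactly supported continuous fields of `R w + ξ`
      set G₁ : EuclideanSpace ℝ (Fin 3) → EuclideanSpace ℝ (Fin 3) := fun x => (fderiv ℝ Φ x) (deriv R t (Rinv t (x - ξ t))) with hG₁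
      set G₂ : EuclideanSpace ℝ (Fin 3) → EuclideanSpace ℝ (Fin 3) := fun x => (fderiv ℝ Φ x) (deriv ξ t) with hG₂
      have hG₁c : Continuous G₁ := hDΦc.clm_apply ((deriv R t).continuous.comp ((Rinv t).continuous.comp (continuous_id.sub continuous_const)))
      have hG₂c : Continuous G₂ := hDΦc.clm_apply continuous_const
      have hG₁s : HasCompactSupport G₁ := by
        refine hDΦs.mono ?_  -- `support G₁ ⊆ support DΦ`
        intro x hx
        by_contra h0
        exact hx (by simp only [hG₁, Function.notMem_support.1 h0, zero_apply])
      have hG₂s : HasCompactSupport G₂ := hΦ.hasCompactSupport.fderiv_apply (𝕜 := ℝ) (deriv ξ t)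
      have j1 := integrable_inner_rigid hU (R t) (hRi t) hG₁c hG₁s (ξ t)
      have j2 := integrable_inner_rigid hU (R t) (hRi t) hG₂c hG₂s (ξ t)
      have e : (fun w => ⟪R t (U w), (fderiv ℝ Φ (R t w + ξ t)) (deriv R t w + deriv ξ t)⟫) =
          fun w => ⟪R t (U w), G₁ (R t w + ξ t)⟫ + ⟪R t (U w), G₂ (R t w + ξ t)⟫ := by
        funext w
        simp only [hG₁, hG₂, map_add, inner_add_right, add_sub_cancel_right, h2]
      rw [e]
      exact j1.add j2
    rw [← integral_add i1 i2]
    refine h.congr_deriv (integral_congr_ae (Eventually.of_forall fun w => rfl))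
  have hg : Continuous fun t : ℝ => (∫ w, ⟪deriv R t (U w), Φ (R t w + ξ t)⟫) +
      ∫ w, ⟪R t (U w), (fderiv ℝ Φ (R t w + ξ t)) (deriv R t w + deriv ξ t)⟫ :=
    (continuous_integral_inner_rigid_path hU hξ.continuous hRc hRi hR'c hΦc hΦ.hasCompactSupport).add
      (continuous_integral_inner_rigid_clm_path hU hξ.continuous hRc hRi hRc hR'c (hξ.continuous_deriv le_rfl) hDΦc hDΦs)
  have hN : Continuous fun t : ℝ => ∫ w, ⟪R t (U w), (fderiv ℝ Φ (R t w + ξ t)) (R t (U w))⟫ :=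
    continuous_integral_inner_rigid_clm_self hUm hU2 hξ.continuous hRc hRi hDΦc hDΦs
  exact eq_of_integral_deriv_mul_add_eq_zero
    (f := fun t => ∫ w, ⟪R t (U w), Φ (R t w + ξ t)⟫)
    (g := fun t => (∫ w, ⟪deriv R t (U w), Φ (R t w + ξ t)⟫) +
      ∫ w, ⟪R t (U w), (fderiv ℝ Φ (R t w + ξ t)) (deriv R t w + deriv ξ t)⟫)
    (N := fun t => ∫ w, ⟪R t (U w), (fderiv ℝ Φ (R t w + ξ t)) (R t (U w))⟫)
    hder hg hN
    (fun χ hχ hχc hχT => integral_tensorTest_rigid hsol hT₁ hu hUm hU hU2 hξ.continuous hRc hRinv hRi h1 h2 hΦ hdiv hχ hχc hχT) hτ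

end RigidFrame

end Summit.NavierStokesRegularity.NavierStokesRegularity.Theorems.PowerGaugeEulerLiouville

end
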